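import Summits.Ventures.HodgeRepro2.T6N43Main
import Summits.Ventures.HodgeRepro2.T5HalfPlaneHolomorphy
import Summits.Ventures.HodgeRepro2.T5HalfPlaneIdentity
import Summits.Ventures.HodgeRepro2.T5CartanU11

/-!
# T6N43HalfPlane — the continuation clause of (N4.3.P1): `zeta` is holomorphic on `Re s > 1/2 − ε`

Record: TIER5 v0.51 §N4.3 (N4.3.P1), ll. 1280–1282: «the absolute convergence at s = 1/2 proved above
propagates to the whole HALF-PLANE Re s ≥ 1/2 … the integral converges absolutely on the OPEN set
Re s > 1/2 − ε and is holomorphic there (ref-2 N-T5N4.1′); this half-plane contains the region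
Re s ≫ 0 in which [PS-R87]'s integral defines Z_{τ′_j}(s) (R3.1), so on Re s ≥ 1/2 the integral IS the
meromorphic continuation, in particular at s = 1/2.» In kernel: over the U(1,1) datum with the binders
of `N43_main_U11` minus the L-factor display, `zeta 𝒟` (the Bochner integral for every s) is
holomorphic on `{s | 1/2 − ε < s.re}` for every ε < 4 (`zeta_differentiableOn`; p1's
T5HalfPlaneHolomorphy.differentiableOn_integral_shift with c = ⟨ω(g)φ,φ⟩·conj⟨π₀(g)f,f⟩ and
a = |a(i(g,1))| = cosh(η/2)⁻¹, the domination `‖c‖ · a^{−ε} = ‖φ‖²‖f‖² cosh(η/2)^{ε−6}` integrable by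
p1's `T5CoshIntegral.epsilon_bound_integrable` through the (A-2f) display and η = 2t). Together with
p1's `T5HalfPlaneIdentity.eq_at_half_of_eqOn_subHalfPlane` this is the kernel form of the sentence
«on Re s ≥ 1/2 the integral IS the meromorphic continuation»: any function holomorphic on the
half-plane and equal to the integral for Re s ≫ 0 equals it at s = 1/2 (`zeta_half_eq_of_eqOn`).
Axioms: {propext, Classical.choice, Quot.sound}. §8(d): uses an L-value-free non-vanishing device: NO.
-/

namespace Summit.Ventures.HodgeRepro2.T6

open MeasureTheory Complex
open scoped NNReal ENNReal

namespace ArchDoublingDatum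

variable {H : Type*} [MeasurableSpace H]

/-- On U(1,1) the Cartan factor is `cosh(η/2)⁻¹` with `η` Rühl's parameter (p1's
`T5CartanU11.aNorm_eq_inv_cosh`: `|a(i(g,1))| = 1/cosh(arsinh ‖g₁₀‖)`). -/
theorem aFac_eq (𝒟 : ArchDoublingDatum H T5UnitaryBound.MemU11) (g : H) :
    𝒟.aFac g = (Real.cosh (𝒟.eta g / 2))⁻¹ := by
  unfold aFac eta
  rw [T5CartanU11.aNorm_eq_inv_cosh (𝒟.rep_mem g)]
  congr 2
  ring

/-- `0 < |a(i(g,1))|` on U(1,1) (p1's `aNorm_pos`). -/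
theorem aFac_pos (𝒟 : ArchDoublingDatum H T5UnitaryBound.MemU11) (g : H) : 0 < 𝒟.aFac g :=
  T5UnitaryBound.aNorm_pos (𝒟.rep_mem g)

/-- `|a(i(g,1))| ≤ 1` on U(1,1) — the CLAIM of (N4.3.P1) (p1's `aNorm_le_one`). -/
theorem aFac_le_one (𝒟 : ArchDoublingDatum H T5UnitaryBound.MemU11) (g : H) : 𝒟.aFac g ≤ 1 :=
  T5UnitaryBound.aNorm_le_one (𝒟.rep_mem g)

/-- The Cartan factor is a measurable function on `H`. -/
theorem measurable_aFac (𝒟 : ArchDoublingDatum H T5UnitaryBound.MemU11) : Measurable 𝒟.aFac := by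
  have h : 𝒟.aFac = fun g => (Real.cosh (𝒟.eta g / 2))⁻¹ := funext 𝒟.aFac_eq
  rw [h]
  exact (Real.continuous_cosh.measurable.comp (𝒟.measurable_eta.div_const 2)).inv

/-- `zeta` in the shape `s ↦ ∫ c(g) · a(g)^{s − 1/2}` of p1's half-plane lemma. -/
theorem zeta_eq_shift {P : Matrix (Fin 2) (Fin 2) ℂ → Prop} (𝒟 : ArchDoublingDatum H P) :
    𝒟.zeta = fun s => ∫ g, (𝒟.coeffW g * (starRingEnd ℂ) (𝒟.coeffπ g)) *
      ((𝒟.aFac g : ℂ) ^ (s - 1 / 2)) ∂𝒟.μ := by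
  funext s
  unfold zeta
  congr 1
  funext g
  ring

/-- The domination integrand of (N4.3.P1): `‖c(g)‖ · a(g)^{−ε} = ‖φ‖²‖f‖² cosh(η(g)/2)^{ε − 6}`. -/
theorem norm_integrand_mul_aFac_rpow (𝒟 : ArchDoublingDatum H T5UnitaryBound.MemU11)
    (hP2 : 𝒟.FockLineIdentification) (hP2' : 𝒟.LowestWeightCoefficient) (ε : ℝ) (g : H) :
    ‖𝒟.coeffW g * (starRingEnd ℂ) (𝒟.coeffπ g)‖ * 𝒟.aFac g ^ (-ε) =
      (𝒟.normφ ^ 2 * 𝒟.normf ^ 2) * Real.cosh (𝒟.eta g / 2) ^ (ε - 6) := by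
  have hc : 0 < Real.cosh (𝒟.eta g / 2) := Real.cosh_pos _
  have hnf : 𝒟.normf ≠ 0 := 𝒟.normf_pos.ne'
  have e1 : (𝒟.normφ ^ 2 / 𝒟.normf ^ 2) * (𝒟.normf ^ 4 * Real.cosh (𝒟.eta g / 2) ^ (-6 : ℤ)) =
      (𝒟.normφ ^ 2 * 𝒟.normf ^ 2) * Real.cosh (𝒟.eta g / 2) ^ (-6 : ℤ) := by
    field_simp
  rw [𝒟.integrand_eq hP2 g, 𝒟.normSq_coeffπ hP2' g, 𝒟.aFac_eq g, Complex.norm_real,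
    Real.norm_eq_abs, abs_of_nonneg (by positivity), Real.inv_rpow hc.le, Real.rpow_neg hc.le,
    inv_inv, e1, show (ε - 6 : ℝ) = ((-6 : ℤ) : ℝ) + ε by push_cast; ring, Real.rpow_add hc,
    Real.rpow_intCast, mul_assoc]

/-- The radial domination integrand is integrable on `(0, ∞)` for `ε < 4` (p1's
`T5CoshIntegral.epsilon_bound_integrable` in the variable `t = η/2`). -/
theorem integrableOn_radial_rpow {ε : ℝ} (hε : ε < 4) (A : ℝ) :
    IntegrableOn (fun η : ℝ => (1 / 2 * Real.sinh η) * (A * Real.cosh (η / 2) ^ (ε - 6)))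
      (Set.Ioi (0 : ℝ)) volume := by
  have h1 : IntegrableOn (fun t : ℝ => A / 2 * (Real.cosh t ^ (ε - 6) * Real.sinh (2 * t)))
      (Set.Ioi (0 : ℝ)) volume :=
    (T5CoshIntegral.epsilon_bound_integrable ε hε).const_mul (A / 2)
  have h2 : IntegrableOn
      (fun t : ℝ => (1 / 2 * Real.sinh (2 * t)) * (A * Real.cosh ((2 * t) / 2) ^ (ε - 6)))
      (Set.Ioi (0 : ℝ)) volume := by
    refine h1.congr_fun (fun t _ => ?_) measurableSet_Ioi
    rw [show (2 * t) / 2 = t by ring]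
    ring
  have h3 := (integrableOn_Ioi_comp_mul_left_iff
    (fun η : ℝ => (1 / 2 * Real.sinh η) * (A * Real.cosh (η / 2) ^ (ε - 6))) (0 : ℝ)
    (two_pos : (0 : ℝ) < 2)).mp h2
  simpa only [mul_zero] using h3

/-- THEOREM N4.3 (a), the continuation clause of (N4.3.P1): the doubling integral converges absolutely
and is holomorphic on the half-plane `Re s > 1/2 − ε` for every `ε < 4`. -/
theorem zeta_differentiableOn (𝒟 : ArchDoublingDatum H T5UnitaryBound.MemU11)
    (hP2 : 𝒟.FockLineIdentification) (hP2' : 𝒟.LowestWeightCoefficient)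
    (hA2f : Hyp.Ruhl1970_A2f 𝒟) {ε : ℝ} (hε : ε < 4) :
    DifferentiableOn ℂ 𝒟.zeta {s | 1 / 2 - ε < s.re} := by
  rw [zeta_eq_shift]
  have hnf : 𝒟.normf ≠ 0 := 𝒟.normf_pos.ne'
  -- measurability of the coefficient
  have hpt : (fun g => 𝒟.coeffW g * (starRingEnd ℂ) (𝒟.coeffπ g)) =
      fun g => (((𝒟.normφ ^ 2 * 𝒟.normf ^ 2) * Real.cosh (𝒟.eta g / 2) ^ (-6 : ℤ) : ℝ) : ℂ) := by
    funext g
    rw [𝒟.integrand_eq hP2 g, 𝒟.normSq_coeffπ hP2' g]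
    congr 1
    field_simp
  have hF6 : Measurable fun η : ℝ => Real.cosh (η / 2) ^ (-6 : ℤ) :=
    ((Real.continuous_cosh.comp (continuous_id.div_const 2)).zpow₀ (-6)
      (fun _ => Or.inl (Real.cosh_pos _).ne')).measurable
  have hcmeas : AEStronglyMeasurable (fun g => 𝒟.coeffW g * (starRingEnd ℂ) (𝒟.coeffπ g)) 𝒟.μ := by
    rw [hpt]
    exact (Complex.continuous_ofReal.measurable.comp
      ((hF6.comp 𝒟.measurable_eta).const_mul _)).aestronglyMeasurable
  -- the domination
  have hdom : Integrable (fun g => ‖𝒟.coeffW g * (starRingEnd ℂ) (𝒟.coeffπ g)‖ * 𝒟.aFac g ^ (-ε))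
      𝒟.μ := by
    have hfun : (fun g => ‖𝒟.coeffW g * (starRingEnd ℂ) (𝒟.coeffπ g)‖ * 𝒟.aFac g ^ (-ε)) =
        fun g => (𝒟.normφ ^ 2 * 𝒟.normf ^ 2) * Real.cosh (𝒟.eta g / 2) ^ (ε - 6) :=
      funext (𝒟.norm_integrand_mul_aFac_rpow hP2 hP2' ε)
    rw [hfun]
    obtain ⟨c, hc, hmap⟩ := hA2f
    have hF : Measurable fun η : ℝ => (𝒟.normφ ^ 2 * 𝒟.normf ^ 2) * Real.cosh (η / 2) ^ (ε - 6) :=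
      (((Real.continuous_cosh.comp (continuous_id.div_const 2)).rpow_const
        (fun _ => Or.inl (Real.cosh_pos _).ne')).measurable).const_mul _
    have h1 : Integrable (fun g => (𝒟.normφ ^ 2 * 𝒟.normf ^ 2) * Real.cosh (𝒟.eta g / 2) ^ (ε - 6))
        𝒟.μ ↔ Integrable (fun η : ℝ => (𝒟.normφ ^ 2 * 𝒟.normf ^ 2) * Real.cosh (η / 2) ^ (ε - 6))
        (Measure.map 𝒟.eta 𝒟.μ) :=
      (integrable_map_measure hF.aestronglyMeasurable 𝒟.measurable_eta.aemeasurable).symm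
    rw [h1, hmap, integrable_smul_measure (ENNReal.ofReal_pos.mpr hc).ne' ENNReal.ofReal_ne_top]
    have h2 : (fun η : ℝ => ENNReal.ofReal (1 / 2 * Real.sinh η)) =
        fun η : ℝ => ((Real.toNNReal (1 / 2 * Real.sinh η) : ℝ≥0) : ℝ≥0∞) := rfl
    have hmeas : Measurable fun η : ℝ => Real.toNNReal (1 / 2 * Real.sinh η) :=
      (Real.measurable_sinh.const_mul (1 / 2)).real_toNNReal
    rw [h2, integrable_withDensity_iff_integrable_smul hmeas]
    refine (integrableOn_radial_rpow hε (𝒟.normφ ^ 2 * 𝒟.normf ^ 2)).congr_fun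
      (fun η hη => ?_) measurableSet_Ioi
    simp only [NNReal.smul_def, smul_eq_mul]
    rw [Real.coe_toNNReal _ (by
      have : 0 < Real.sinh η := Real.sinh_pos_iff.mpr hη
      positivity)]
  exact T5HalfPlaneHolomorphy.differentiableOn_integral_shift hcmeas 𝒟.measurable_aFac
    𝒟.aFac_pos 𝒟.aFac_le_one hdom

/-- The identity-principle form of «on Re s ≥ 1/2 the integral IS the meromorphic continuation»: a
function `Zc` holomorphic on `Re s > 1/2 − ε` (0 < ε < 4) and equal to the integral `zeta` on some
half-plane `Re s > R` (R ≥ 1/2 − ε; GQT's region of convergence Re s ≫ 0) equals it at `s = 1/2`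
(p1's `T5HalfPlaneIdentity.eq_at_half_of_eqOn_subHalfPlane`). -/
theorem zeta_half_eq_of_eqOn (𝒟 : ArchDoublingDatum H T5UnitaryBound.MemU11)
    (hP2 : 𝒟.FockLineIdentification) (hP2' : 𝒟.LowestWeightCoefficient)
    (hA2f : Hyp.Ruhl1970_A2f 𝒟) {ε R : ℝ} (hε0 : 0 < ε) (hε : ε < 4) (hR : 1 / 2 - ε ≤ R)
    {Zc : ℂ → ℂ} (hZc : DifferentiableOn ℂ Zc {s | 1 / 2 - ε < s.re})
    (hEq : Set.EqOn Zc 𝒟.zeta {s | R < s.re}) :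
    Zc (1 / 2) = 𝒟.zeta (1 / 2) :=
  T5HalfPlaneIdentity.eq_at_half_of_eqOn_subHalfPlane hε0 hR hZc
    (𝒟.zeta_differentiableOn hP2 hP2' hA2f hε) hEq

end ArchDoublingDatum

end Summit.Ventures.HodgeRepro2.T6
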